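import Summits.ResolutionOfSingularities.ResolutionOfSingularities.Theorems.HilbertSamuelEliminationSigmaMaxModificationsCorridor3SigmaTameLowCoeff
import Literature.AlgebraicGeometry.Resolution.QuadraticTransformsUFD
import Mathlib.RingTheory.UniqueFactorizationDomain.Basic
import HarnessLib

/-!
# [OURS · L1 W4.2] σ-LAYER, TAME-LOW row T-L2, FILE 1a supplement — `Corridor3SigmaTameLowCoeffUnique`: THE RESIDUAL FACTOR `𝔞♮` IS CANONICAL
# (crux chain w42 `SigmaMaxModifications` stmt-ResolutionOfSingularities-18506 / conjunct `SigmaMaxModificationsCorridor3` stmt-ResolutionOfSingularities-19249;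
# completes the «no uniqueness claimed» item lane B (res-ref-b12, p558585) recorded on FILE 1a; seat res-L1-type-o2 g9 = «res-type-067/068 SUCCESSOR»;
# `--supports stmt-ResolutionOfSingularities-19249 --as helper`, counted 0)

HONEST FRAMING. OURS, classical commutative algebra (Lipman 1969 p. 51 «uniquely `P·I`») PROVED over Mathlib's UFD API and the tree's
`uniqueFactorizationMonoid_of_ringKrullDim_eq_two` (two-dimensional regular local rings are factorial); no definition, no named fact, no axiom. NOTHING here
is a statement of H. Hironaka's manuscript [Hironaka2017] nor of Cossart–Jannsen–Saito. AI-typed; AI review weaker than expert review.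

## Contents (namespace `…Theorems.SigmaMaxModificationsCorridor3.Sigma.TameLow`)

* `residual_unique` — in a UFD, `(g)·J₀ = (h)·J₁` (`g ≠ 0`) with `J₀`, `J₁` in no proper principal ideal ⇒ `J₀ = J₁ ∧ (g) = (h)` (reduce `g, h` by their
  common factor, `UniqueFactorizationMonoid.exists_reduced_factors`; a reduced factor dividing every element of a residual ideal is a unit).
* `CoeffDatum.residual_eq_of_factorisation` / `principal_span_eq_of_factorisation` — ANY factorisation `𝔞 = (G)·J₀` with `J₀` residual has
  `J₀ = D.residual` and `(G) = (𝔪on·g)`: FILE 1a's chosen `residual` is the intrinsic one, so `basePointCount` depends on `(R, 𝔞)` only.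
* `CoeffDatum.residual_eq_of_coeff_eq` — two data on the SAME germ with the same coefficient ideal have the same residual factor (two readings of one
  lineage point agree on `𝔞♮`), `extIdeal_map_inclusion_self`, `idealBaseTree_residual_eq_of_coeff_eq`, `basePointCount_eq_of_coeff_eq` (… hence on the
  base tree and the base-point count).
-/

noncomputable section

set_option linter.dupNamespace false -- mandated namespace of this single-conjunct summit

open IsLocalRing Literature.AlgebraicGeometry.Resolution

namespace Summit.ResolutionOfSingularities.ResolutionOfSingularities.Theorems.SigmaMaxModificationsCorridor3.Sigma.TameLow

universe u

/-! ## §1. Uniqueness of the residual factor in a UFD -/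

section Unique

variable {A : Type u} [CommRing A] [IsDomain A] [UniqueFactorizationMonoid A]

/-- **UNIQUENESS OF THE RESIDUAL FACTOR** in a UFD: if `(g)·J₀ = (h)·J₁` (`g ≠ 0`) with `J₀`, `J₁` contained in no proper principal ideal `(q)`
(`q` a non-unit), then `J₀ = J₁` and `(g) = (h)`. [cite: Lipman1969, Part II §1 p. 51] -/
theorem residual_unique {g h : A} (hg : g ≠ 0) {J₀ J₁ : Ideal A}
    (h₀ : ∀ q : A, ¬ IsUnit q → ¬ J₀ ≤ Ideal.span {q}) (h₁ : ∀ q : A, ¬ IsUnit q → ¬ J₁ ≤ Ideal.span {q})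
    (heq : Ideal.span {g} * J₀ = Ideal.span {h} * J₁) : J₀ = J₁ ∧ Ideal.span {g} = Ideal.span {h} := by
  obtain ⟨g', h', d, hrel, hgd, hhd⟩ := UniqueFactorizationMonoid.exists_reduced_factors g hg h
  have hd : d ≠ 0 := fun hd0 => hg (by rw [← hgd, hd0, zero_mul])
  have hg' : g' ≠ 0 := fun h0 => hg (by rw [← hgd, h0, mul_zero])
  -- cancel the common factor `d`
  have heq' : Ideal.span {g'} * J₀ = Ideal.span {h'} * J₁ := by
    have : Ideal.span {d} * (Ideal.span {g'} * J₀) = Ideal.span {d} * (Ideal.span {h'} * J₁) := by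
      rw [← mul_assoc, ← mul_assoc, Ideal.span_singleton_mul_span_singleton, Ideal.span_singleton_mul_span_singleton, hgd, hhd, heq]
    exact (Ideal.span_singleton_mul_right_inj hd).mp this
  -- the reduced factor `g'` divides every element of `J₁`, hence is a unit; symmetrically `h'`
  have hg'u : IsUnit g' := by
    by_contra hnu
    refine h₁ g' hnu fun j hj => ?_
    have hmem : h' * j ∈ Ideal.span {g'} * J₀ := by
      rw [heq']
      exact Ideal.mul_mem_mul (Ideal.mem_span_singleton_self h') hj
    have hdvd : g' ∣ h' * j := Ideal.mem_span_singleton.mp (Ideal.mul_le_right hmem)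
    exact Ideal.mem_span_singleton.mpr (hrel.dvd_of_dvd_mul_left hdvd)
  have hh' : h' ≠ 0 := by
    intro h0
    have : Ideal.span {g'} * J₀ = ⊥ := by rw [heq', h0, Ideal.span_singleton_eq_bot.mpr rfl, Ideal.bot_mul]
    rcases Ideal.mul_eq_bot.mp this with h1 | h1
    · exact hg' (Ideal.span_singleton_eq_bot.mp h1)
    · exact h₀ 0 not_isUnit_zero (h1 ▸ bot_le)
  have hh'u : IsUnit h' := by
    by_contra hnu
    refine h₀ h' hnu fun j hj => ?_
    have hmem : g' * j ∈ Ideal.span {h'} * J₁ := by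
      rw [← heq']
      exact Ideal.mul_mem_mul (Ideal.mem_span_singleton_self g') hj
    have hdvd : h' ∣ g' * j := Ideal.mem_span_singleton.mp (Ideal.mul_le_right hmem)
    exact Ideal.mem_span_singleton.mpr (hrel.symm.dvd_of_dvd_mul_left hdvd)
  have hsg : Ideal.span {g'} = ⊤ := Ideal.span_singleton_eq_top.mpr hg'u
  have hsh : Ideal.span {h'} = ⊤ := Ideal.span_singleton_eq_top.mpr hh'u
  refine ⟨?_, ?_⟩
  · rw [hsg, hsh, Ideal.top_mul, Ideal.top_mul] at heq'
    exact heq'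
  · rw [← hgd, ← hhd, ← Ideal.span_singleton_mul_span_singleton, ← Ideal.span_singleton_mul_span_singleton, hsg, hsh]

end Unique

namespace CoeffDatum

variable {K : Type u} [Field K] (D : CoeffDatum K)

/-- **THE RESIDUAL FACTOR `𝔞♮` IS CANONICAL**: any factorisation `𝔞 = (G)·J₀` (`G ≠ 0`) with `J₀` in no proper principal ideal has `J₀ = D.residual`
(the two-dimensional regular local ring is a UFD — tree `uniqueFactorizationMonoid_of_ringKrullDim_eq_two`). Hence `basePointCount` depends on `(R, 𝔞)`
only, not on the chosen factorisation. [cite: Lipman1969, Part II §1 p. 51] -/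
theorem residual_eq_of_factorisation {G : D.R} (hG : G ≠ 0) {J₀ : Ideal D.R} (hJ₀ : ∀ q : D.R, ¬ IsUnit q → ¬ J₀ ≤ Ideal.span {q})
    (h : D.coeff = Ideal.span {G} * J₀) : J₀ = D.residual := by
  haveI := D.isRegularLocalRing
  haveI : IsDomain D.R := isDomain_of_isRegularLocalRing D.R
  haveI : UniqueFactorizationMonoid D.R := uniqueFactorizationMonoid_of_ringKrullDim_eq_two D.ringKrullDim_eq_two
  have h2 : Ideal.span {G} * J₀ = Ideal.span {D.monomial * D.principalPart} * D.residual := by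
    rw [← h, D.coeff_eq, Ideal.span_singleton_mul_span_singleton]
  exact (residual_unique hG hJ₀ (fun q hq => D.residual_not_le_span_singleton hq) h2).1

/-- … and the principal part is canonical as an ideal: `(G) = (𝔪on · g)`. [cite: Lipman1969, Part II §1 p. 51] -/
theorem principal_span_eq_of_factorisation {G : D.R} (hG : G ≠ 0) {J₀ : Ideal D.R} (hJ₀ : ∀ q : D.R, ¬ IsUnit q → ¬ J₀ ≤ Ideal.span {q})
    (h : D.coeff = Ideal.span {G} * J₀) : Ideal.span {G} = Ideal.span {D.monomial * D.principalPart} := by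
  haveI := D.isRegularLocalRing
  haveI : IsDomain D.R := isDomain_of_isRegularLocalRing D.R
  haveI : UniqueFactorizationMonoid D.R := uniqueFactorizationMonoid_of_ringKrullDim_eq_two D.ringKrullDim_eq_two
  have h2 : Ideal.span {G} * J₀ = Ideal.span {D.monomial * D.principalPart} * D.residual := by
    rw [← h, D.coeff_eq, Ideal.span_singleton_mul_span_singleton]
  exact (residual_unique hG hJ₀ (fun q hq => D.residual_not_le_span_singleton hq) h2).2

/-- **Same germ, same coefficient ideal ⇒ same residual factor** (two readings of one point agree on `𝔞♮`). [folklore] -/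
theorem residual_eq_of_coeff_eq (D D' : CoeffDatum K) (hR : D'.R = D.R)
    (hc : D'.coeff.map (Subring.inclusion hR.le) = D.coeff) :
    D'.residual.map (Subring.inclusion hR.le) = D.residual := by
  haveI := D.isRegularLocalRing
  haveI := D'.isRegularLocalRing
  -- transport `D'`'s factorisation along the (identity) inclusion
  have hinj : Function.Injective (Subring.inclusion hR.le) := Subring.inclusion_injective hR.le
  have hsurj : Function.Surjective (Subring.inclusion hR.le) := by
    rintro ⟨x, hx⟩
    exact ⟨⟨x, hR ▸ hx⟩, rfl⟩
  have hfac : D.coeff = Ideal.span {Subring.inclusion hR.le (D'.monomial * D'.principalPart)} * D'.residual.map (Subring.inclusion hR.le) := by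
    rw [← hc, D'.coeff_eq, Ideal.span_singleton_mul_span_singleton, Ideal.map_mul, Ideal.map_span, Set.image_singleton]
  refine (D.residual_eq_of_factorisation ?_ (fun q hq hle => ?_) hfac)
  · intro h0
    exact mul_ne_zero D'.monomial_ne_zero D'.principalPart_ne_zero (hinj (by rw [h0, map_zero]))
  · -- pull `(q)` back to `D'.R`: `q = ι q'` and `D'.residual ≤ (q')`
    obtain ⟨q', rfl⟩ := hsurj q
    refine D'.residual_not_le_span_singleton (q := q') (fun hu => hq (hu.map _)) fun j hj => ?_
    have : Subring.inclusion hR.le j ∈ Ideal.span {Subring.inclusion hR.le q'} := hle (Ideal.mem_map_of_mem _ hj)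
    obtain ⟨t, ht⟩ := Ideal.mem_span_singleton'.mp this
    obtain ⟨t', rfl⟩ := hsurj t
    refine Ideal.mem_span_singleton'.mpr ⟨t', hinj ?_⟩
    rw [map_mul, ht]

/-- Along the identity inclusion, extending `J.map ι` or `J` to an over-ring gives the same ideal. [folklore] -/
theorem extIdeal_map_inclusion_self {R S : Subring K} (hRS : R ≤ S) (J : Ideal R) :
    extIdeal (J.map (Subring.inclusion (le_refl R))) S = extIdeal J S := by
  rw [extIdeal_eq_map _ hRS, extIdeal_eq_map J hRS, Ideal.map_map]
  rfl

/-- **With equal germ and equal coefficient ideal the BASE TREES agree** (so do the base-point counts). [folklore] -/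
theorem idealBaseTree_residual_eq_of_coeff_eq (D D' : CoeffDatum K) (hR : D'.R = D.R)
    (hc : D'.coeff.map (Subring.inclusion hR.le) = D.coeff) :
    idealBaseTree D'.R D'.residual = idealBaseTree D.R D.residual := by
  have hres := residual_eq_of_coeff_eq D D' hR hc
  obtain ⟨R', h1, h2, h3, m', S', h4, h5, mem', tr', h6, c', h7⟩ := D'
  cases hR
  ext S
  simp only [idealBaseTree, Set.mem_setOf_eq]
  refine and_congr_right fun hS => ?_
  rw [← hres, extIdeal_map_inclusion_self (subringDominates_of_reflTransGen hS).1]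

/-- With equal germ and equal coefficient ideal the base-point counts agree. [folklore] -/
theorem basePointCount_eq_of_coeff_eq (D D' : CoeffDatum K) (hR : D'.R = D.R)
    (hc : D'.coeff.map (Subring.inclusion hR.le) = D.coeff) : D'.basePointCount = D.basePointCount := by
  unfold basePointCount
  rw [idealBaseTree_residual_eq_of_coeff_eq D D' hR hc]

end CoeffDatum

end Summit.ResolutionOfSingularities.ResolutionOfSingularities.Theorems.SigmaMaxModificationsCorridor3.Sigma.TameLow

end
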